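import Summits.BirchSwinnertonDyer.BirchSwinnertonDyer.Theorems.ManinLocalTwoThreeEulerRemaindersTwentySeven
import Summits.BirchSwinnertonDyer.BirchSwinnertonDyer.Theorems.ManinLocalTwoThreeEtaIdentityReductionTwentySeven
import Summits.BirchSwinnertonDyer.BirchSwinnertonDyer.Theorems.ManinLocalTwoThreeEtaCubicTwentySeven
import HarnessLib

/-!
# Ligozat's `η`-identities at level 27 and `|c| = 1` on `X₀(27)` — unconditionally

Cell bsd-f2-manin, route `ManinLocalTwoThree`.  We discharge the `q`-asymptotics (T1), (T2) at `i∞`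
((T3) is the tree's `EtaCubic.tendsto_ligozat_cubic_twentySeven`) to which
`EtaIdentityReduction.abs_maninConstant_eq_one_twentySeven_of_tendsto` had reduced the fact-free
Manin-constant-one theorem on `X₀(27)`:

  (T1) `((2πi)⁻¹x′ + φ₂₇(2u + 9))/q → 0`,  (T2) `((2πi)⁻¹u′ + 3φ₂₇x²)/q → 0`,
  (T3) `x³ − u² − 9u − 27 → 0`,

for Ligozat's `x = η(9τ)⁴/(η(3τ)η(27τ)³) = E₉⁴/(q²E₃E₂₇³)`, `u = η(3τ)³/η(27τ)³ = E₃³/(q³E₂₇³)` and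
`φ₂₇ = η(3τ)²η(9τ)² = qE₃²E₉²`.  METHOD.  By the logarithmic derivatives of `x` and `u`
(`deriv_ligozatX`, `deriv_ligozatU`) each target is `G/(q^k · unit)` with `G` a polynomial in
`q, E₃, E₉, E₂₇, E₃′, E₉′, E₂₇′` and `k ∈ {3, 4}`; the remainder calculus
(`ManinLocalTwoThreeQRemainderCalculus`) computes `G` modulo `o(q⁸)` from `E₃ ≡ 1 − q³ − q⁶`,
`(2πi)⁻¹E₃′ ≡ −3q³ − 6q⁶`, `E₉ ≡ E₂₇ ≡ 1`, `E₉′ ≡ E₂₇′ ≡ 0 (mod q⁹)`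
(`ManinLocalTwoThreeEulerRemaindersTwentySeven`), and in each case the truncation vanishes
identically modulo `X⁹` (a polynomial identity checked by `ring`), so `G = o(q⁸)` and the target tends
to `0`.  CONSEQUENCES (§3): Ligozat's identities `x′ = −2πiφ₂₇(2u + 9)`, `u′ = −6πiφ₂₇x²`,
`x³ = u² + 9u + 27` on `ℍ`; (S2) `Λ(φ₂₇) ⊆ Λ(0, 27)`; and **`|D.maninConstant| = 1` for every globally
minimal `W/ℚ` and every `X₀(27)`-parametrisation datum `D` of `W` with the lattice clause** — with no
modularity, CDT or printed Manin-constant hypothesis (`abs_maninConstant_eq_one_twentySeven`), hence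
`3 ∤ c` there (`not_three_dvd_maninConstant_twentySeven`, the crux `ManinPrimeToThreeAtNine` at `N = 27`
without its fact hypotheses).  Classical source of the identities: G. Ligozat, *Courbes modulaires de
genre 1*, Mém. SMF 43 (1975) (level 27).  BSD is not proved by this; C2/C3 stay open as filed.
-/

set_option autoImplicit false
set_option linter.dupNamespace false

noncomputable section

open Complex Filter Topology Set Asymptotics Polynomial
open UpperHalfPlane hiding I
open scoped Real Topology Manifold MatrixGroups
open Literature.NumberTheory.EllipticCurves Literature.NumberTheory.EllipticCurves.ModularForms

namespace Summit.BirchSwinnertonDyer.BirchSwinnertonDyer.Theorems.ManinLocalTwoThree.LigozatIdentities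

open QRemainder EulerRemainders

/-! ## 1. The derivatives of `x` and `u` -/

/-- `E_δ ∘ ofComplex` is differentiable at every point of `ℍ`. [folklore] -/
theorem hasDerivAt_eulerFn_comp (δ : ℕ) (τ : ℍ) :
    HasDerivAt (eulerFn δ ∘ ofComplex) (deriv (eulerFn δ ∘ ofComplex) τ) τ :=
  (((UpperHalfPlane.mdifferentiable_iff.mp (mdifferentiable_eulerFn δ)) τ τ.im_pos).differentiableAt
    (isOpen_upperHalfPlaneSet.mem_nhds τ.im_pos)).hasDerivAt

/-- **`x′ = x · (4E₉′/E₉ − 2·2πi − E₃′/E₃ − 3E₂₇′/E₂₇)`** (logarithmic derivative of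
`x = E₉⁴/(q²E₃E₂₇³)`). [folklore] -/
theorem deriv_ligozatX (τ : ℍ) :
    deriv (etaQuotient 27 (expFn [(3, -1), (9, 4), (27, -3)]) ∘ ofComplex) τ
      = eulerFn 9 τ ^ 4 / (Function.Periodic.qParam 1 (τ : ℂ) ^ 2 * eulerFn 3 τ * eulerFn 27 τ ^ 3)
        * (4 * deriv (eulerFn 9 ∘ ofComplex) τ / eulerFn 9 τ - 2 * (2 * π * I)
          - deriv (eulerFn 3 ∘ ofComplex) τ / eulerFn 3 τ
          - 3 * deriv (eulerFn 27 ∘ ofComplex) τ / eulerFn 27 τ) := by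
  have hE3 := eulerFn_ne_zero (by norm_num : 0 < 3) τ
  have hE9 := eulerFn_ne_zero (by norm_num : 0 < 9) τ
  have hE27 := eulerFn_ne_zero (by norm_num : 0 < 27) τ
  have hq := qParam_ne_zero τ
  have hfun : (etaQuotient 27 (expFn [(3, -1), (9, 4), (27, -3)]) ∘ ofComplex) =ᶠ[𝓝 (τ : ℂ)]
      fun z ↦ (eulerFn 9 ∘ ofComplex) z ^ 4 / (Function.Periodic.qParam 1 z ^ 2
        * (eulerFn 3 ∘ ofComplex) z * (eulerFn 27 ∘ ofComplex) z ^ 3) := by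
    filter_upwards [isOpen_upperHalfPlaneSet.mem_nhds τ.im_pos] with z hz
    simp only [Function.comp_apply, ligozatX_eq, ofComplex_apply_of_im_pos hz]
  rw [hfun.deriv_eq]
  have h9 := hasDerivAt_eulerFn_comp 9 τ
  have h3 := hasDerivAt_eulerFn_comp 3 τ
  have h27 := hasDerivAt_eulerFn_comp 27 τ
  have hqd : HasDerivAt (Function.Periodic.qParam 1) (2 * π * I * Function.Periodic.qParam 1 (τ : ℂ)) τ := by
    simpa using hasDerivAt_qParam 1 (τ : ℂ)
  have hden : Function.Periodic.qParam 1 (τ : ℂ) ^ 2 * (eulerFn 3 ∘ ofComplex) τ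
      * (eulerFn 27 ∘ ofComplex) τ ^ 3 ≠ 0 := by
    simp only [Function.comp_apply, ofComplex_apply]
    exact mul_ne_zero (mul_ne_zero (pow_ne_zero _ hq) hE3) (pow_ne_zero _ hE27)
  have hD := (h9.fun_pow 4).fun_div (((hqd.fun_pow 2).fun_mul h3).fun_mul (h27.fun_pow 3)) hden
  rw [hD.deriv]
  simp only [Function.comp_apply, ofComplex_apply]
  field_simp
  ring

/-- **`u′ = u · (3E₃′/E₃ − 3·2πi − 3E₂₇′/E₂₇)`** (logarithmic derivative of `u = E₃³/(q³E₂₇³)`).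
[folklore] -/
theorem deriv_ligozatU (τ : ℍ) :
    deriv (etaQuotient 27 (expFn [(3, 3), (27, -3)]) ∘ ofComplex) τ
      = eulerFn 3 τ ^ 3 / (Function.Periodic.qParam 1 (τ : ℂ) ^ 3 * eulerFn 27 τ ^ 3)
        * (3 * deriv (eulerFn 3 ∘ ofComplex) τ / eulerFn 3 τ - 3 * (2 * π * I)
          - 3 * deriv (eulerFn 27 ∘ ofComplex) τ / eulerFn 27 τ) := by
  have hE3 := eulerFn_ne_zero (by norm_num : 0 < 3) τ
  have hE27 := eulerFn_ne_zero (by norm_num : 0 < 27) τ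
  have hq := qParam_ne_zero τ
  have hfun : (etaQuotient 27 (expFn [(3, 3), (27, -3)]) ∘ ofComplex) =ᶠ[𝓝 (τ : ℂ)]
      fun z ↦ (eulerFn 3 ∘ ofComplex) z ^ 3 / (Function.Periodic.qParam 1 z ^ 3
        * (eulerFn 27 ∘ ofComplex) z ^ 3) := by
    filter_upwards [isOpen_upperHalfPlaneSet.mem_nhds τ.im_pos] with z hz
    simp only [Function.comp_apply, ligozatU_eq, ofComplex_apply_of_im_pos hz]
  rw [hfun.deriv_eq]
  have h3 := hasDerivAt_eulerFn_comp 3 τ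
  have h27 := hasDerivAt_eulerFn_comp 27 τ
  have hqd : HasDerivAt (Function.Periodic.qParam 1) (2 * π * I * Function.Periodic.qParam 1 (τ : ℂ)) τ := by
    simpa using hasDerivAt_qParam 1 (τ : ℂ)
  have hden : Function.Periodic.qParam 1 (τ : ℂ) ^ 3 * (eulerFn 27 ∘ ofComplex) τ ^ 3 ≠ 0 := by
    simp only [Function.comp_apply, ofComplex_apply]
    exact mul_ne_zero (pow_ne_zero _ hq) (pow_ne_zero _ hE27)
  have hD := (h3.fun_pow 3).fun_div ((hqd.fun_pow 3).fun_mul (h27.fun_pow 3)) hden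
  rw [hD.deriv]
  simp only [Function.comp_apply, ofComplex_apply]
  field_simp
  ring

/-! ## 2. The `q`-asymptotics (T1), (T2) at `i∞` -/

/-- **(T1)**: `((2πi)⁻¹x′ + φ₂₇(2u + 9))/q → 0` at `i∞`. [folklore] -/
theorem tendsto_T1 :
    Tendsto (fun τ : ℍ ↦ ((2 * π * I)⁻¹
      * deriv (etaQuotient 27 (expFn [(3, -1), (9, 4), (27, -3)]) ∘ ofComplex) τ
      + cuspFormEtaProductTwentySeven τ * (2 * etaQuotient 27 (expFn [(3, 3), (27, -3)]) τ + 9))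
      / Function.Periodic.qParam 1 (τ : ℂ)) atImInfty (𝓝 0) := by
  have h2pi : (2 * π * I : ℂ) ≠ 0 := by simp [Real.pi_ne_zero, I_ne_zero]
  have hE3 := tendsto_eulerFn_three
  have hE9 := tendsto_eulerFn (δ := 9) (m := 8) (by norm_num)
  have hE27 := tendsto_eulerFn (δ := 27) (m := 8) (by norm_num)
  have hB := QRemainder.reduce (1 - 3 * X ^ 3) (5 - 3 * X ^ 6 - X ^ 9) (by ring) (QRemainder.pow hE3 3)
  -- `T_δ = (2πi)⁻¹ E_δ′`: `T₃ = −3q³ − 6q⁶ + o(q⁸)`, `T₉, T₂₇ = o(q⁸)`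
  have hT3 := QRemainder.congr_poly (P' := -3 * X ^ 3 - 6 * X ^ 6)
    (by rw [← mul_assoc, ← map_mul, inv_mul_cancel₀ h2pi, map_one, one_mul])
    (QRemainder.const_mul (2 * π * I)⁻¹ tendsto_deriv_eulerFn_three)
  have hT9 := QRemainder.congr_poly (P' := 0) (by rw [mul_zero])
    (QRemainder.const_mul (2 * π * I)⁻¹ (tendsto_deriv_eulerFn (δ := 9) (m := 8) (by norm_num)))
  have hT27 := QRemainder.congr_poly (P' := 0) (by rw [mul_zero])
    (QRemainder.const_mul (2 * π * I)⁻¹ (tendsto_deriv_eulerFn (δ := 27) (m := 8) (by norm_num)))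
  -- `G₁ = E₉³(4T₉E₃E₂₇ − 2E₉E₃E₂₇ − E₉T₃E₂₇ − 3E₉E₃T₂₇) + 2(E₃³)²E₃E₉²E₂₇ + 9q³(E₃³E₃E₉²E₂₇⁴) = o(q⁸)`
  have hA := QRemainder.mul (QRemainder.mul (QRemainder.const_mul 4 hT9) hE3) hE27
  have hB' := QRemainder.mul (QRemainder.mul (QRemainder.const_mul 2 hE9) hE3) hE27
  have hC := QRemainder.mul (QRemainder.mul hE9 hT3) hE27
  have hD := QRemainder.mul (QRemainder.mul (QRemainder.const_mul 3 hE9) hE3) hT27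
  have h1 := QRemainder.mul (QRemainder.pow hE9 3) (QRemainder.sub (QRemainder.sub (QRemainder.sub hA hB') hC) hD)
  have h2 := QRemainder.mul (QRemainder.mul (QRemainder.mul
    (QRemainder.const_mul 2 (QRemainder.pow hB 2)) hE3) (QRemainder.pow hE9 2)) hE27
  have h3 := QRemainder.const_mul 9 (QRemainder.qParam_pow_mul 3 (QRemainder.mul (QRemainder.mul
    (QRemainder.mul hB hE3) (QRemainder.pow hE9 2)) (QRemainder.pow hE27 4)))
  have hG := QRemainder.reduce 0 (12 + 9 * X ^ 3) (by simp only [map_ofNat]; ring)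
    (QRemainder.add (QRemainder.add h1 h2) h3)
  have hlim := (QRemainder.tendsto_div_pow 3 (by norm_num) hG).mul
    ((((isIntUnitQExp_eulerFn (by norm_num : 0 < 3)).tendsto_one.pow 2).mul
      ((isIntUnitQExp_eulerFn (by norm_num : 0 < 27)).tendsto_one.pow 4)).inv₀ (by norm_num))
  rw [zero_mul] at hlim
  refine hlim.congr fun τ ↦ ?_
  have hE3' := eulerFn_ne_zero (by norm_num : 0 < 3) τ
  have hE9' := eulerFn_ne_zero (by norm_num : 0 < 9) τ
  have hE27' := eulerFn_ne_zero (by norm_num : 0 < 27) τ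
  have hq := qParam_ne_zero τ
  rw [deriv_ligozatX, ligozatU_eq, etaProductTwentySeven_eq]
  field_simp
  ring

/-- **(T2)**: `((2πi)⁻¹u′ + 3φ₂₇x²)/q → 0` at `i∞`. [folklore] -/
theorem tendsto_T2 :
    Tendsto (fun τ : ℍ ↦ ((2 * π * I)⁻¹
      * deriv (etaQuotient 27 (expFn [(3, 3), (27, -3)]) ∘ ofComplex) τ
      + cuspFormEtaProductTwentySeven τ * (3 * etaQuotient 27 (expFn [(3, -1), (9, 4), (27, -3)]) τ ^ 2))
      / Function.Periodic.qParam 1 (τ : ℂ)) atImInfty (𝓝 0) := by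
  have h2pi : (2 * π * I : ℂ) ≠ 0 := by simp [Real.pi_ne_zero, I_ne_zero]
  have hE3 := tendsto_eulerFn_three
  have hE9 := tendsto_eulerFn (δ := 9) (m := 8) (by norm_num)
  have hE27 := tendsto_eulerFn (δ := 27) (m := 8) (by norm_num)
  have hT3 := QRemainder.congr_poly (P' := -3 * X ^ 3 - 6 * X ^ 6)
    (by rw [← mul_assoc, ← map_mul, inv_mul_cancel₀ h2pi, map_one, one_mul])
    (QRemainder.const_mul (2 * π * I)⁻¹ tendsto_deriv_eulerFn_three)
  have hT27 := QRemainder.congr_poly (P' := 0) (by rw [mul_zero])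
    (QRemainder.const_mul (2 * π * I)⁻¹ (tendsto_deriv_eulerFn (δ := 27) (m := 8) (by norm_num)))
  -- `G₂ = 3E₃²E₂₇²(T₃E₂₇ − E₃E₂₇ − E₃T₂₇) + 3E₉¹⁰ = o(q⁸)`
  have h1 := QRemainder.mul (QRemainder.const_mul 3 (QRemainder.mul (QRemainder.pow hE3 2)
    (QRemainder.pow hE27 2))) (QRemainder.sub (QRemainder.sub (QRemainder.mul hT3 hE27)
    (QRemainder.mul hE3 hE27)) (QRemainder.mul hE3 hT27))
  have h2 := QRemainder.const_mul 3 (QRemainder.pow hE9 10)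
  have hG := QRemainder.reduce 0 (30 - 36 * X ^ 6 - 15 * X ^ 9) (by simp only [map_ofNat]; ring)
    (QRemainder.add h1 h2)
  have hlim := (QRemainder.tendsto_div_pow 4 (by norm_num) hG).mul
    (((isIntUnitQExp_eulerFn (by norm_num : 0 < 27)).tendsto_one.pow 6).inv₀ (by norm_num))
  rw [zero_mul] at hlim
  refine hlim.congr fun τ ↦ ?_
  have hE3' := eulerFn_ne_zero (by norm_num : 0 < 3) τ
  have hE9' := eulerFn_ne_zero (by norm_num : 0 < 9) τ
  have hE27' := eulerFn_ne_zero (by norm_num : 0 < 27) τ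
  have hq := qParam_ne_zero τ
  rw [deriv_ligozatU, ligozatX_eq, etaProductTwentySeven_eq]
  field_simp

/-! ## 3. Ligozat's identities, (S2), and `|c| = 1` on `X₀(27)` — unconditionally -/

/-- **Ligozat's derivative identity (I2a)**: `x′ = −2πi φ₂₇ (2u + 9)` on `ℍ`. [folklore] -/
theorem ligozat_deriv_x (τ : ℍ) :
    deriv (etaQuotient 27 (expFn [(3, -1), (9, 4), (27, -3)]) ∘ ofComplex) τ
      = -(2 * π * I * cuspFormEtaProductTwentySeven τ)
          * (2 * etaQuotient 27 (expFn [(3, 3), (27, -3)]) τ + 9) :=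
  EtaIdentityReduction.ligozat_deriv_x_of_tendsto tendsto_T1 τ

/-- **Ligozat's derivative identity (I2b)**: `u′ = −2πi φ₂₇ · 3x²` on `ℍ`. [folklore] -/
theorem ligozat_deriv_u (τ : ℍ) :
    deriv (etaQuotient 27 (expFn [(3, 3), (27, -3)]) ∘ ofComplex) τ
      = -(2 * π * I * cuspFormEtaProductTwentySeven τ)
          * (3 * etaQuotient 27 (expFn [(3, -1), (9, 4), (27, -3)]) τ ^ 2) :=
  EtaIdentityReduction.ligozat_deriv_u_of_tendsto tendsto_T2 τ

/-- **Ligozat's cubic (I1)**: `x³ = u² + 9u + 27` on `ℍ` — the `η`-quotients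
`x = η(9τ)⁴/(η(3τ)η(27τ)³)`, `u = η(3τ)³/η(27τ)³` parametrise the affine curve `X³ = U² + 9U + 27`
(a model of `X₀(27) = 27a1`). [folklore] -/
theorem ligozat_cubic (τ : ℍ) :
    etaQuotient 27 (expFn [(3, -1), (9, 4), (27, -3)]) τ ^ 3
      = etaQuotient 27 (expFn [(3, 3), (27, -3)]) τ ^ 2
        + 9 * etaQuotient 27 (expFn [(3, 3), (27, -3)]) τ + 27 :=
  EtaIdentityReduction.ligozat_cubic_of_deriv ligozat_deriv_x ligozat_deriv_u EtaCubic.tendsto_ligozat_cubic_twentySeven τ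

/-- **(S2) unconditionally**: the period lattice of `φ₂₇ = η(3τ)²η(9τ)²` lies in the lattice of the
Weierstrass pair with invariants `g₂ = 0`, `g₃ = 27`. [folklore] -/
theorem periodLatticeLeHex_twentySeven :
    ∃ L₁ : PeriodPair, L₁.g₂ = 0 ∧ L₁.g₃ = 27 ∧
      ∀ z ∈ periodLattice cuspFormEtaProductTwentySeven, z ∈ L₁.lattice :=
  EtaIdentityReduction.periodLatticeLeHex_of_tendsto tendsto_T1 tendsto_T2 EtaCubic.tendsto_ligozat_cubic_twentySeven

/-- **`|c| = 1` on `X₀(27)`, unconditionally**: for every globally minimal `W/ℚ` and every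
`X₀(27)`-parametrisation datum `D` of `W` with the lattice clause `Λ_W = c·Λ_f`, the Manin constant
satisfies `|c| = 1` — no modularity, CDT or printed Manin-constant fact is assumed. [folklore] -/
theorem abs_maninConstant_eq_one_twentySeven (W : WeierstrassCurve ℚ) [W.IsGloballyMinimal]
    (D : ModularParametrizationData W 27)
    (hopt : ∀ z ∈ D.L.lattice, ∃ w ∈ periodLattice D.f, z = D.c * w) :
    |D.maninConstant| = 1 :=
  EtaIdentityReduction.abs_maninConstant_eq_one_twentySeven_of_tendsto tendsto_T1 tendsto_T2 EtaCubic.tendsto_ligozat_cubic_twentySeven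
    W D hopt

/-- **`3 ∤ c` on `X₀(27)`, unconditionally** (the shape of the crux `ManinPrimeToThreeAtNine` at the
level `N = 27`, with none of its four fact hypotheses). [folklore] -/
theorem not_three_dvd_maninConstant_twentySeven (W : WeierstrassCurve ℚ) [W.IsGloballyMinimal]
    (D : ModularParametrizationData W 27)
    (hopt : ∀ z ∈ D.L.lattice, ∃ w ∈ periodLattice D.f, z = D.c * w) :
    ¬ (3 : ℤ) ∣ D.maninConstant := by
  intro h
  have h1 := abs_maninConstant_eq_one_twentySeven W D hopt
  obtain ⟨k, hk⟩ := h
  rw [hk, abs_mul] at h1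
  have : (3 : ℤ) ∣ 1 := ⟨|k|, by rw [← h1]; simp⟩
  omega

end Summit.BirchSwinnertonDyer.BirchSwinnertonDyer.Theorems.ManinLocalTwoThree.LigozatIdentities

end
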